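import Summits.ABC.IUTFork.Cor312EdgeRegions
import Summits.ABC.IUTFork.Cor312StatementBridge
import HarnessLib

/-!
# The fork at [IUTchIII] Corollary 3.12 — the readings of Step (xi) and the chain's real edges ON THE REAL CONTAINERS

Record-only file (D-0012) of the abc-iut cell (Cor. 3.12 sub-crew, wave 2, seat abc-iut-c312-6, board row W2-C; written at
c312-2's request 19:35Z "instantiate V-b on your verbatimSetting … that puts the readings on REAL containers"); TAKES NO SIDE.
c312-2's chain file IV (`Cor312Chain`) isolates the ONE place where real numbers enter the printed proof of Cor. 3.12 —
`RealEdges O V` (finiteness + the (xi-f) inclusion "`−|log(q)| ∈ ℝ_{≤−|log(Θ)|}`" read off the observation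
`Obs.constitutesConstruction`); its V-b (`Cor312EdgeRegions`) reads the edge at REGION level over a skeleton
`Cor312Setting`: each of the three readings (LANA §8.3 `RepresentedVol`; `QSubHull`; (xi-g)/(IPL) `QIsImage`) and LANA's
(9-1) gives the edges, and `edge_not_imp_readings` shows the edge gives none of them back. This file instantiates all
of it on the two REAL settings of W2-C:

* §1 on `Cor312Vol.toCor312Setting H` — the skeleton setting OF THE PRINTED STATEMENT (c312-7's `Cor312.Setting P`,
  `Cor312StatementBridge`): `verbatimVolumes H hq : Cor312Proof.Volumes` (`hq : P.AbsLogQPos`, "|log(q)| > 0"), with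
  `verbatimVolumes_cor312_iff : (verbatimVolumes H hq).Cor312 ↔ P.Statement`, `realEdges_verbatim_iff :
  RealEdges O (verbatimVolumes H hq) ↔ (O .constitutesConstruction → P.Statement)`, the readings in c312-7's nouns ⟹
  `RealEdges` (`realEdges_of_qRegion_mem_possibleImages` / `_of_qRegion_subset_thetaHull` / `_of_represented` /
  `_of_mainGoal_verbatim`), and `statement_of_chain_verbatim` (all loci ∧ the chain ∧ a reading ⟹ the printed statement).
* §2 INSIDE A REAL CONTAINER the edge is weaker than every reading: the `(ℝ, Lebesgue)` toy of `Cor312Bridge` with the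
  `q`-image `[2, 5/2]` — `Cor312` holds (`log ½ ≤ 0`), so the real edges hold for EVERY reading `O` of the 36 observations,
  while `RepresentedVol` (`0 ≠ log ½`), `QSubHull` (`2 ∉ [0,1]`), `QIsImage` and (9-1) all FAIL
  (`verbatim_edge_not_imp_readings`) — c312-2's `edge_not_imp_readings`, now with an honest measure.

[claim: Mochizuki2012, status: disputed] [cite: LANA2026Report, §8.3 p. 43, §9.2 (9-1) p. 46]
Deliberately NOT here: per-observation truth values for the Scholze–Stix / LANA positions (c312-2 19:35Z: neither text
says which of (xi-a)…(xi-e) it denies — assigning them would editorialise); any judgement.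
-/

noncomputable section

open Set MeasureTheory

namespace Summit.ABC

namespace IUTFork

namespace Cor312Vol

open Thm311 Cor312 Cor312Proof

/-! ## 1. The chain's real edges for the printed statement -/

section Printed

variable {T : ThetaIndex} {S : Situation T} {P : Cor312.Setting S}

/-- "`|log(q)| > 0`" for the skeleton setting of the printed statement: `negAbsLogq < 0` IS c312-7's `AbsLogQPos`.
[folklore] -/
theorem toCor312Setting_negAbsLogq_neg (H : BridgeHyps P) (hq : P.AbsLogQPos) :
    (toCor312Setting H).negAbsLogq < 0 := by
  rw [toCor312Setting_negAbsLogq H]; exact hq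

/-- **The chain's `Volumes` OF THE PRINTED STATEMENT** (c312-2 `Volumes.ofSetting` on `toCor312Setting H`):
`−|log(Θ)| ∈ ℝ`, `−|log(q)| < 0`. [claim: Mochizuki2012, status: disputed] -/
def verbatimVolumes (H : BridgeHyps P) (hq : P.AbsLogQPos) : Volumes :=
  Volumes.ofSetting (toCor312Setting H) (toCor312Setting_negAbsLogq_neg H hq)

/-- Their `Cor312` is the printed `Statement`. [claim: Mochizuki2012, status: disputed] -/
theorem verbatimVolumes_cor312_iff (H : BridgeHyps P) (hq : P.AbsLogQPos) :
    (verbatimVolumes H hq).Cor312 ↔ P.Statement := by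
  rw [verbatimVolumes, Volumes.ofSetting_cor312_iff, statement_iff_cor312 H]

/-- **The real edges for the printed statement** = "(xi-f)'s observation ⟹ the printed inequality".
[claim: Mochizuki2012, status: disputed] -/
theorem realEdges_verbatim_iff (H : BridgeHyps P) (hq : P.AbsLogQPos) (O : Obs → Prop) :
    RealEdges O (verbatimVolumes H hq) ↔ (O .constitutesConstruction → P.Statement) := by
  rw [verbatimVolumes, realEdges_ofSetting_iff, statement_iff_cor312 H]

/-- READING 3 in c312-7's nouns (the `q`-pilot image is a possible image in every packet; (xi-g)/(IPL)) granted
under (xi-f)'s observation ⟹ the real edges. [claim: Mochizuki2012, status: disputed] -/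
theorem realEdges_of_qRegion_mem_possibleImages (H : BridgeHyps P) (hq : P.AbsLogQPos) {O : Obs → Prop}
    (h : O .constitutesConstruction →
      ∀ (i : Fin T.lstar) (vQ : T.VQ), P.qRegion (Setting.labelSucc i) vQ ∈ P.possibleImages _ vQ) :
    RealEdges O (verbatimVolumes H hq) :=
  (realEdges_verbatim_iff H hq O).2 fun hc => statement_of_qRegion_mem_possibleImages H (h hc)

/-- READING 2 in c312-7's nouns (the `q`-pilot image lies in the packet hull `^{n,∘}𝒰_{j,v_ℚ}`) ⟹ the real edges.
[claim: Mochizuki2012, status: disputed] -/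
theorem realEdges_of_qRegion_subset_thetaHull (H : BridgeHyps P) (hq : P.AbsLogQPos) {O : Obs → Prop}
    (h : O .constitutesConstruction →
      ∀ (i : Fin T.lstar) (vQ : T.VQ), P.qRegion (Setting.labelSucc i) vQ ⊆ P.thetaHull _ vQ) :
    RealEdges O (verbatimVolumes H hq) :=
  (realEdges_verbatim_iff H hq O).2 fun hc => statement_of_qRegion_subset_thetaHull H (h hc)

/-- READING 1 (LANA §8.3: some global choice of possible images has the `q`-pilot log-volume) ⟹ the real edges.
[cite: LANA2026Report, §8.3 p. 43] -/
theorem realEdges_of_represented (H : BridgeHyps P) (hq : P.AbsLogQPos) {O : Obs → Prop}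
    (h : O .constitutesConstruction →
      ∃ U : ImageChoice P, (toLocalFamily P H.mono).assemble.logvol (Set.univ.pi U.1) = P.negLogQ) :
    RealEdges O (verbatimVolumes H hq) :=
  (realEdges_verbatim_iff H hq O).2 fun hc => statement_of_represented H (h hc)

/-- LANA (9-1) for the printed statement's `η`-setting ⟹ the real edges for EVERY reading `O` (the chain is not used;
LANA p. 44 "We believe that if the problem described in the “main goal” below is solved, then Corollary 3.12
… will follow" — LANA's own hedge: (9-1) is stated as their belief about what would suffice, not as a proof).
[cite: LANA2026Report, §9 p. 44, §9.2 (9-1) p. 46] -/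
theorem realEdges_of_mainGoal_verbatim (H : BridgeHyps P) (hq : P.AbsLogQPos) (Rval : PointedLine)
    (h : ((toCor312Setting H).toEtaSetting Rval).MainGoal) (O : Obs → Prop) : RealEdges O (verbatimVolumes H hq) :=
  realEdges_of_mainGoal (toCor312Setting H) (toCor312Setting_negAbsLogq_neg H hq) Rval h O

/-- **All 85 loci ∧ the 20-step chain ∧ the author's edge read as Reading 1 ⟹ the PRINTED statement** (c312-2
`cor312_of_chain` instantiated on the printed statement's volumes; the content is in the three hypotheses).
[claim: Mochizuki2012, status: disputed] -/
theorem statement_of_chain_verbatim (H : BridgeHyps P) (hq : P.AbsLogQPos) {L : Locus → Prop} {O : Obs → Prop}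
    (hL : ∀ c, L c) (hC : Chain L O)
    (h : O .constitutesConstruction →
      ∃ U : ImageChoice P, (toLocalFamily P H.mono).assemble.logvol (Set.univ.pi U.1) = P.negLogQ) :
    P.Statement :=
  (verbatimVolumes_cor312_iff H hq).1 (cor312_of_chain hL hC (realEdges_of_represented H hq h))

end Printed

/-! ## 2. Inside a real container, the edge is weaker than every reading -/

section Witness

/-- The `(ℝ, Lebesgue)` toy setting of `Cor312Bridge` with `q`-image `[2, 5/2]`: one possible image `[0,1]` (log-volume
`0`), `−|log(q)| = log ½ < 0`. [folklore] -/
def readingsWitness : Cor312Setting := toySetting 2 (5 / 2) (by norm_num)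

/-- `−|log(q)| = log ½` in the witness. [folklore] -/
theorem readingsWitness_negAbsLogq : readingsWitness.negAbsLogq = Real.log (1 / 2) := by
  show toyFamily.assemble.logvol (toyBox 2 (5 / 2)) = _
  rw [toyFamily_logvol (by norm_num : (2 : ℝ) < 5 / 2)]
  norm_num

/-- `−|log(Θ)| = 0` in the witness. [folklore] -/
theorem readingsWitness_negLogTheta : readingsWitness.negLogTheta = 0 := by
  show toyFamily.assemble.logvol (toyFamily.assemble.hull (⋃ _ : Unit, toyBox 0 1)) = 0
  rw [toyFamily_hull_box, toyFamily_logvol one_pos, sub_zero, Real.log_one]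

/-- `|log(q)| > 0` in the witness. [folklore] -/
theorem readingsWitness_hq : readingsWitness.negAbsLogq < 0 := by
  rw [readingsWitness_negAbsLogq]; exact Real.log_neg (by norm_num) (by norm_num)

/-- The single possible image of the witness has log-volume `0`. [folklore] -/
theorem readingsWitness_logvol_U (i : readingsWitness.Idx) : readingsWitness.logvol (readingsWitness.U i) = 0 := by
  show toyFamily.assemble.logvol (toyBox 0 1) = 0
  rw [toyFamily_logvol one_pos, sub_zero, Real.log_one]

/-- **Inside the real container the edge gives back none of the readings**: the real edges hold for EVERY reading
`O` (the inequality holds: `log ½ ≤ 0`), while Reading 1 fails (`0 ≠ log ½`), Reading 2 fails (the constant function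
`2` lies in the `q`-box but not in the hull box `[0,1]`), hence Reading 3 and LANA's (9-1) fail — c312-2's
`edge_not_imp_readings` with Lebesgue measure in place of a counting toy. [folklore] -/
theorem verbatim_edge_not_imp_readings :
    (∀ O : Obs → Prop, RealEdges O (Volumes.ofSetting readingsWitness readingsWitness_hq)) ∧
      ¬ readingsWitness.RepresentedVol ∧ ¬ readingsWitness.QSubHull ∧ ¬ readingsWitness.QIsImage ∧
        ∀ Rval, ¬ (readingsWitness.toEtaSetting Rval).MainGoal := by
  have hcor : readingsWitness.Cor312 := by
    unfold Cor312Setting.Cor312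
    rw [readingsWitness_negAbsLogq, readingsWitness_negLogTheta]
    exact (Real.log_neg (by norm_num) (by norm_num)).le
  have hrep : ¬ readingsWitness.RepresentedVol := by
    rintro ⟨i, h⟩
    rw [readingsWitness_logvol_U i, readingsWitness_negAbsLogq] at h
    exact (Real.log_neg (by norm_num : (0 : ℝ) < 1 / 2) (by norm_num)).ne' h
  have hsub : ¬ readingsWitness.QSubHull := by
    intro h
    have hmem : (fun (_ : Unit) (_ : Unit) => (2 : ℝ)) ∈ readingsWitness.Q :=
      Set.mem_univ_pi.mpr fun _ => Set.mem_univ_pi.mpr fun _ => ⟨le_rfl, by norm_num⟩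
    have h2 := h hmem
    change (fun (_ : Unit) (_ : Unit) => (2 : ℝ)) ∈ toyFamily.assemble.hull (⋃ _ : Unit, toyBox 0 1) at h2
    rw [toyFamily_hull_box] at h2
    have h3 : (2 : ℝ) ∈ Set.Icc (0 : ℝ) 1 :=
      (Set.mem_univ_pi.mp ((Set.mem_univ_pi.mp h2) ())) ()
    exact absurd h3.2 (by norm_num)
  refine ⟨fun O => (realEdges_ofSetting_iff _ _ O).2 fun _ => hcor, hrep, hsub,
    fun h => hrep (readingsWitness.representedVol_of_qIsImage h), fun Rval h => ?_⟩
  exact hrep ((readingsWitness.mainGoal_iff_representedVol Rval).1 h)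

end Witness

end Cor312Vol

end IUTFork

end Summit.ABC

end
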